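import Literature.NumberTheory.LFunctions.Zhang2022.NumericsSection12ExactB

/-!
# Zhang (2022) §12: the (12.17) window certificate read out at the threshold `3.6·10⁻⁶` (num lane N-07/N-08, part C)

Trunk T-ANT (NumberTheory/LFunctions). Continuation of `NumericsSection12ExactB.lean` (Y. Zhang, arXiv:2211.02515v1
[Zhang2022LandauSiegel], §12 — **an unrefereed manuscript under adjudication; nothing here is a statement about its
theorems or about Landau–Siegel zeros**). ZHANG-L lane, WP12, piece W5 of the RT-02 node `Win1217Ex` (R-18).

`NumericsSection12ExactB.eq1217_exact_and_lin` certifies the integrated conclusion of §12 in the EXACT main-value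
reading, `‖(e2starW wExact + conj (e2starBarW wStarExact)) − 2e₂*‖ < 10⁻⁵` (true value `3.49·10⁻⁶`), against the
printed tolerance `10⁻⁵`. The re-typed node `Win1217Ex` (RETYPE-LEDGER RT-02) carries the tolerance `κ = 5·10⁻⁶` at
every large `D`, and its closer needs room below `κ` for the `D → ∞` convergence of the window integrals; this file
reads the SAME tree box `E17x` out at the sharper threshold `3.6·10⁻⁶` (`cert1217T`, `decide +kernel` on the
fixed-point endpoints; margin to the true value ≈ 3%), giving `eq1217_exact_lt_36 : ‖…‖ < 3.6·10⁻⁶` and hence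
`1.4·10⁻⁶` of room under `κ`. No new boxes, no new definitions.
-/

noncomputable section

open Complex Real ComplexConjugate
open Literature.Analysis.ValidatedNumerics.Numerics

namespace Literature.NumberTheory.LFunctions.Zhang2022.Numerics

open Literature.NumberTheory.LFunctions.Zhang2022

/- Keep the interval primitives opaque to the elaborator's unifier (as in `NumericsSection12ExactB`). -/
attribute [local irreducible] CB.add CB.sub CB.mul CB.neg CB.conj CB.mulFI CB.mulI CB.mulInt
  CB.ofFI CB.ofInt CB.normSqFI CB.expI FI.add FI.sub FI.mul FI.neg FI.mulInt FI.divNat FI.divPos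
  FI.ofRat FI.ofInt FI.pi qCB piMul expIpi overPiFI piISq eIpiB overPiB

/-- **The kernel check, sharpened**: the (12.17) box `E17x` (exact reading: `E15x + conj E16x`) has
`normSq < (3.6·10⁻⁶)² = 1.296·10⁻¹¹` (threshold `q·2⁴⁸` against the integer endpoint; true value `(3.49·10⁻⁶)²`).
[cite: Zhang2022LandauSiegel, §12 (12.17) p.73] -/
theorem cert1217T : (E17x.normSqFI.hi : ℚ) < (81/6250000000000 : ℚ) * (SC : ℚ) := by
  decide +kernel

/-- From `normSq z < (3.6·10⁻⁶)²`: `‖z‖ < 3.6·10⁻⁶`. [folklore] -/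
private theorem norm_lt_36 {z : ℂ} (h : Complex.normSq z < ((81/6250000000000 : ℚ) : ℝ)) :
    ‖z‖ < 3.6e-6 := by
  rw [Complex.normSq_eq_norm_sq] at h
  have h2 : ((81/6250000000000 : ℚ) : ℝ) = (3.6e-6 : ℝ) ^ 2 := by norm_num
  rw [h2] at h
  exact lt_of_pow_lt_pow_left₀ 2 (by norm_num) h

/-- **(12.17), exact main-value reading, sharpened**: the window values replace `2e₂*` within `3.6·10⁻⁶`,
`‖(e2starW wExact + conj (e2starBarW wStarExact)) − 2e₂*‖ < 3.6·10⁻⁶` (true value `3.49·10⁻⁶`; the re-typed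
node `Win1217Ex` allows `5·10⁻⁶`). [cite: Zhang2022LandauSiegel, §12 (12.17) p.73] -/
theorem eq1217_exact_lt_36 :
    ‖(e2starW wExact + conj (e2starBarW wStarExact)) - 2 * e2star‖ < 3.6e-6 := by
  rw [xi15_shift_eq]
  have hm : CB.mem ((e2starW wExact - e2star) + conj (e2starBarW wStarExact - conj e2star)) E17x := by
    unfold E17x; exact CB.mem_add mem_E15x (CB.mem_conj mem_E16x)
  exact norm_lt_36 (hi_bound (CB.mem_normSqFI hm) cert1217T)

/-- The same bound in the `≤` form with a rational-free decimal, for `linarith` consumers.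
[cite: Zhang2022LandauSiegel, §12 (12.17) p.73] -/
theorem eq1217_exact_le_36 :
    ‖(e2starW wExact + conj (e2starBarW wStarExact)) - 2 * e2star‖ ≤ 3.6e-6 :=
  eq1217_exact_lt_36.le

end Literature.NumberTheory.LFunctions.Zhang2022.Numerics
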